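import Mathlib
import HarnessLib
import Summits.Ventures.LatticeQCDFlow.Exactness.IMHDelayedRejectionExact
import Summits.Ventures.LatticeQCDFlow.Exactness.OffDiagonalDominationLagOne
import Summits.Ventures.LatticeQCDFlow.Exactness.RefreshScan

/-!
# LatticeQCDFlow / Exactness — THE DELAYED-REJECTION FLOW SAMPLER'S RATE: it inherits the plain sampler's Doeblin
# minorisation (uniform ergodicity at rate `(1 − 1/W)ᵗ`) and decorrelates every observable at least as much at lag one

HONEST FRAMING: exact (Metropolis-corrected) sampling algorithms for lattice gauge theory;
figures of merit are autocorrelation/cost numbers at stated couplings and volumes; no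
continuum-physics claim.

Venture `LatticeQCDFlow` (cell pub-lqcd), topic `Exactness`, FANOUT row 30 (lean-1 GEN-43, theme SECOND CHANCES;
sequel of `IMHDelayedRejectionExact`).  NEW WORK of the cell; no definition is introduced, nothing is cited as a
fact.  Tree inputs: `IMHKernel` (`indepMH_apply_ge`, `imhAcceptE_ge_of_le`, `indepMH_invariant`), `RefreshScan`
(`uniformlyErgodic_of_minorised`, the bridge to the Literature Doeblin theorem), `OffDiagonalDominationLagOne`
(`sqDiff_lintegral_mono`, `lagOne_cross_antitone`: the one-step Peskun–Tierney ordering).  Printed counterparts,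
NAMED ONLY: Tierney–Mira 1999 §4 ("the DR chain dominates in the Peskun sense"); Mengersen–Tweedie 1996 Thm 2.1
(uniform ergodicity of the independence sampler iff `w` is bounded).

## Setting and results [all ours]

General measurable `Ω`; flow law `q`; weight `w > 0` measurable; `π = w·q`; `K` = ANY kernel realising the two-stage
delayed-rejection rule of `IMHDelayedRejectionExact` (hypothesis `hK` there, copied verbatim).

* `dr_apply_univ` ∕ `dr_isMarkovKernel`: `K(x, Ω) = 1` — the hypothesis `hK` already makes `K` a Markov kernel.
* `dr_apply_ge_setLIntegral_accept`: `K(x, B) ≥ ∫_B a(x, y) q(dy)` for EVERY `B` (also `B ∋ x`).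
* **`dr_minorisation` ∕ `dr_smul_le`**: if `0 < w ≤ M` then `K(x, B) ≥ M⁻¹·π(B)` from every `x` — Doeblin's condition with
  the SAME constant as the plain flow sampler (`indepMH_apply_ge`): the second stage costs no rate.
* **`dr_uniformlyErgodic`**: for a normalised weight `0 < w ≤ W`, from EVERY initial law `μ₀`, every `t`, every set `A`:
  `|μ₀Kᵗ(A) − π(A)| ≤ (1 − 1/W)ᵗ`.
* **`dr_sqDiff_ge_imh`**: for every observable `f` and every law `μ`, the one-step Dirichlet form of `K` is at least the plain
  sampler's, `∫∫ (f x − f y)² indepMH(x, dy) μ(dx) ≤ ∫∫ (f x − f y)² K(x, dy) μ(dx)` (measurable singletons).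
* **`dr_lagOne_le_imh`**: for bounded measurable `f ≥ 0` and `π` finite, the stationary lag-one product moment is
  SMALLER under delayed rejection: `∫∫ f(x)f(y) K(x, dy) π(dx) ≤ ∫∫ f(x)f(y) indepMH(x, dy) π(dx)` — every observable's
  lag-one autocorrelation can only go down.

Not here: higher lags ∕ asymptotic variance (the full Peskun–Tierney theorem is spectral); the cost side (a second stage
evaluates one more weight — whether it pays is an empirical question); the sticking floor (sequel).
-/

namespace Summit.Ventures.LatticeQCDFlow.Exactness

open MeasureTheory ProbabilityTheory
open scoped ENNReal

variable {Ω : Type*} [MeasurableSpace Ω] {q : Measure Ω} [IsProbabilityMeasure q] {w : Ω → ℝ}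

/-! ## §1 The kernel is Markov and dominates its first stage -/

/-- **`K(x, Ω) = 1`**: with `B = Ω` the two-stage formula reads `m(x) + (1 − m(x)) = 1` (`drMass_le_one`). [ours] -/
theorem dr_apply_univ (hw : Measurable w) (hw0 : ∀ x, 0 < w x) (K : Kernel Ω Ω)
    (hK : ∀ (x : Ω) {B : Set Ω}, MeasurableSet B → K x B =
      ∫⁻ y in B, imhAcceptE w x y ∂q +
        ∫⁻ y₁, ∫⁻ y₂ in B, ENNReal.ofReal (min (1 - imhAccept w x y₁) (w y₂ * (1 - imhAccept w y₂ y₁) / w x)) ∂q ∂q +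
        (1 - (imhAcceptMass q w x +
          ∫⁻ y₁, ∫⁻ y₂, ENNReal.ofReal (min (1 - imhAccept w x y₁) (w y₂ * (1 - imhAccept w y₂ y₁) / w x)) ∂q ∂q)) *
          B.indicator 1 x)
    (x : Ω) : K x Set.univ = 1 := by
  rw [hK x MeasurableSet.univ]
  simp only [Measure.restrict_univ, Set.indicator_univ, Pi.one_apply, mul_one]
  rw [show ∫⁻ y, imhAcceptE w x y ∂q = imhAcceptMass q w x from rfl]
  exact add_tsub_cancel_of_le (drMass_le_one hw hw0 x)

/-- Hence `K` is a Markov kernel. [ours, bookkeeping] -/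
theorem dr_isMarkovKernel (hw : Measurable w) (hw0 : ∀ x, 0 < w x) (K : Kernel Ω Ω)
    (hK : ∀ (x : Ω) {B : Set Ω}, MeasurableSet B → K x B =
      ∫⁻ y in B, imhAcceptE w x y ∂q +
        ∫⁻ y₁, ∫⁻ y₂ in B, ENNReal.ofReal (min (1 - imhAccept w x y₁) (w y₂ * (1 - imhAccept w y₂ y₁) / w x)) ∂q ∂q +
        (1 - (imhAcceptMass q w x +
          ∫⁻ y₁, ∫⁻ y₂, ENNReal.ofReal (min (1 - imhAccept w x y₁) (w y₂ * (1 - imhAccept w y₂ y₁) / w x)) ∂q ∂q)) *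
          B.indicator 1 x) :
    IsMarkovKernel K :=
  ⟨fun x => ⟨dr_apply_univ hw hw0 K hK x⟩⟩

omit [IsProbabilityMeasure q] in
/-- **The first stage is a floor for every set**: `∫_B a(x, y) q(dy) ≤ K(x, B)` (also for `B ∋ x`). [ours] -/
theorem dr_apply_ge_setLIntegral_accept (K : Kernel Ω Ω)
    (hK : ∀ (x : Ω) {B : Set Ω}, MeasurableSet B → K x B =
      ∫⁻ y in B, imhAcceptE w x y ∂q +
        ∫⁻ y₁, ∫⁻ y₂ in B, ENNReal.ofReal (min (1 - imhAccept w x y₁) (w y₂ * (1 - imhAccept w y₂ y₁) / w x)) ∂q ∂q +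
        (1 - (imhAcceptMass q w x +
          ∫⁻ y₁, ∫⁻ y₂, ENNReal.ofReal (min (1 - imhAccept w x y₁) (w y₂ * (1 - imhAccept w y₂ y₁) / w x)) ∂q ∂q)) *
          B.indicator 1 x)
    (x : Ω) {B : Set Ω} (hB : MeasurableSet B) :
    ∫⁻ y in B, imhAcceptE w x y ∂q ≤ K x B := by
  rw [hK x hB, add_assoc]
  exact le_self_add

/-! ## §2 Doeblin's minorisation with the plain sampler's constant, and uniform ergodicity -/

omit [IsProbabilityMeasure q] in
/-- **DOEBLIN FOR DELAYED REJECTION**: if `0 < w ≤ M` then `M⁻¹·π(B) ≤ K(x, B)` for every state `x` and measurable `B` —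
the same constant as `indepMH_apply_ge`. [ours] -/
theorem dr_minorisation (hw : Measurable w) {M : ℝ} (hw0 : ∀ x, 0 < w x) (hM : ∀ x, w x ≤ M) (K : Kernel Ω Ω)
    (hK : ∀ (x : Ω) {B : Set Ω}, MeasurableSet B → K x B =
      ∫⁻ y in B, imhAcceptE w x y ∂q +
        ∫⁻ y₁, ∫⁻ y₂ in B, ENNReal.ofReal (min (1 - imhAccept w x y₁) (w y₂ * (1 - imhAccept w y₂ y₁) / w x)) ∂q ∂q +
        (1 - (imhAcceptMass q w x +
          ∫⁻ y₁, ∫⁻ y₂, ENNReal.ofReal (min (1 - imhAccept w x y₁) (w y₂ * (1 - imhAccept w y₂ y₁) / w x)) ∂q ∂q)) *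
          B.indicator 1 x)
    (x : Ω) {B : Set Ω} (hB : MeasurableSet B) :
    (ENNReal.ofReal M)⁻¹ * (q.withDensity fun y => ENNReal.ofReal (w y)) B ≤ K x B := by
  have hMpos : 0 < M := (hw0 x).trans_le (hM x)
  refine le_trans ?_ (dr_apply_ge_setLIntegral_accept K hK x hB)
  rw [withDensity_apply _ hB]
  calc (ENNReal.ofReal M)⁻¹ * ∫⁻ y in B, ENNReal.ofReal (w y) ∂q
        = ∫⁻ y in B, (ENNReal.ofReal M)⁻¹ * ENNReal.ofReal (w y) ∂q := by
          rw [lintegral_const_mul _ hw.ennreal_ofReal]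
    _ = ∫⁻ y in B, ENNReal.ofReal (w y / M) ∂q := by
          refine lintegral_congr fun y => ?_
          rw [div_eq_inv_mul, ENNReal.ofReal_mul (inv_nonneg.mpr hMpos.le), ENNReal.ofReal_inv_of_pos hMpos]
    _ ≤ ∫⁻ y in B, imhAcceptE w x y ∂q := lintegral_mono fun y => imhAcceptE_ge_of_le hw0 hM x y

omit [IsProbabilityMeasure q] in
/-- The minorisation as a measure inequality: `M⁻¹ • π ≤ K(x, ·)` for every `x`. [ours] -/
theorem dr_smul_le (hw : Measurable w) {M : ℝ} (hw0 : ∀ x, 0 < w x) (hM : ∀ x, w x ≤ M) (K : Kernel Ω Ω)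
    (hK : ∀ (x : Ω) {B : Set Ω}, MeasurableSet B → K x B =
      ∫⁻ y in B, imhAcceptE w x y ∂q +
        ∫⁻ y₁, ∫⁻ y₂ in B, ENNReal.ofReal (min (1 - imhAccept w x y₁) (w y₂ * (1 - imhAccept w y₂ y₁) / w x)) ∂q ∂q +
        (1 - (imhAcceptMass q w x +
          ∫⁻ y₁, ∫⁻ y₂, ENNReal.ofReal (min (1 - imhAccept w x y₁) (w y₂ * (1 - imhAccept w y₂ y₁) / w x)) ∂q ∂q)) *
          B.indicator 1 x)
    (x : Ω) : (ENNReal.ofReal M)⁻¹ • (q.withDensity fun y => ENNReal.ofReal (w y)) ≤ K x := by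
  refine Measure.le_iff.2 fun B hB => ?_
  rw [Measure.smul_apply, smul_eq_mul]
  exact dr_minorisation hw hw0 hM K hK x hB

/-- **THE DELAYED-REJECTION FLOW SAMPLER IS UNIFORMLY ERGODIC AT RATE `(1 − 1/W)ᵗ`** for a normalised weight `0 < w ≤ W`,
from every initial law `μ₀`: `|μ₀Kᵗ(A) − π(A)| ≤ (1 − W⁻¹)ᵗ`. [ours] -/
theorem dr_uniformlyErgodic (hw : Measurable w) (hw0 : ∀ x, 0 < w x) {W : ℝ} (hW : ∀ x, w x ≤ W)
    [IsProbabilityMeasure (q.withDensity fun y => ENNReal.ofReal (w y))] (K : Kernel Ω Ω)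
    (hK : ∀ (x : Ω) {B : Set Ω}, MeasurableSet B → K x B =
      ∫⁻ y in B, imhAcceptE w x y ∂q +
        ∫⁻ y₁, ∫⁻ y₂ in B, ENNReal.ofReal (min (1 - imhAccept w x y₁) (w y₂ * (1 - imhAccept w y₂ y₁) / w x)) ∂q ∂q +
        (1 - (imhAcceptMass q w x +
          ∫⁻ y₁, ∫⁻ y₂, ENNReal.ofReal (min (1 - imhAccept w x y₁) (w y₂ * (1 - imhAccept w y₂ y₁) / w x)) ∂q ∂q)) *
          B.indicator 1 x)
    (μ₀ : Measure Ω) [IsProbabilityMeasure μ₀] (t : ℕ) (A : Set Ω) :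
    |((fun ν : Measure Ω => ν.bind K)^[t] μ₀).real A - (q.withDensity fun y => ENNReal.ofReal (w y)).real A| ≤
      (1 - W⁻¹) ^ t := by
  haveI : IsMarkovKernel K := dr_isMarkovKernel hw hw0 K hK
  have hWpos : 0 < W := by
    obtain ⟨y⟩ := nonempty_of_isProbabilityMeasure q
    exact (hw0 y).trans_le (hW y)
  have h := uniformlyErgodic_of_minorised (dr_smul_le hw hw0 hW K hK) (delayedRejection_invariant hw hw0 K hK) μ₀ t A
  have hε : ((ENNReal.ofReal W)⁻¹).toReal = W⁻¹ := by
    rw [ENNReal.toReal_inv, ENNReal.toReal_ofReal hWpos.le]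
  rwa [hε] at h

/-! ## §3 The one-step Peskun–Tierney ordering against the plain flow sampler -/

/-- **DELAYED REJECTION HAS THE LARGER ONE-STEP DIRICHLET FORM**: for every observable `f` and every law `μ`,
`∫∫ (f x − f y)² indepMH(x, dy) dμ ≤ ∫∫ (f x − f y)² K(x, dy) dμ`. [ours] -/
theorem dr_sqDiff_ge_imh [MeasurableSingletonClass Ω] (hw : Measurable w) (K : Kernel Ω Ω)
    (hK : ∀ (x : Ω) {B : Set Ω}, MeasurableSet B → K x B =
      ∫⁻ y in B, imhAcceptE w x y ∂q +
        ∫⁻ y₁, ∫⁻ y₂ in B, ENNReal.ofReal (min (1 - imhAccept w x y₁) (w y₂ * (1 - imhAccept w y₂ y₁) / w x)) ∂q ∂q +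
        (1 - (imhAcceptMass q w x +
          ∫⁻ y₁, ∫⁻ y₂, ENNReal.ofReal (min (1 - imhAccept w x y₁) (w y₂ * (1 - imhAccept w y₂ y₁) / w x)) ∂q ∂q)) *
          B.indicator 1 x)
    (μ : Measure Ω) (f : Ω → ℝ) :
    ∫⁻ x, ∫⁻ y, ENNReal.ofReal ((f x - f y) ^ 2) ∂(indepMH q w x) ∂μ ≤
      ∫⁻ x, ∫⁻ y, ENNReal.ofReal ((f x - f y) ^ 2) ∂(K x) ∂μ :=
  sqDiff_lintegral_mono K (indepMH q w) (fun _ _ hB hx => dr_apply_ge_indepMH hw K hK hB hx) μ f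

/-- **… AND THE SMALLER STATIONARY LAG-ONE PRODUCT MOMENT OF EVERY BOUNDED OBSERVABLE**: for measurable `0 ≤ f ≤ c`
and `π = w·q` finite, `∫∫ f(x)f(y) K(x, dy) π(dx) ≤ ∫∫ f(x)f(y) indepMH(x, dy) π(dx)`. [ours] -/
theorem dr_lagOne_le_imh [MeasurableSingletonClass Ω] (hw : Measurable w) (hw0 : ∀ x, 0 < w x) (K : Kernel Ω Ω)
    (hK : ∀ (x : Ω) {B : Set Ω}, MeasurableSet B → K x B =
      ∫⁻ y in B, imhAcceptE w x y ∂q +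
        ∫⁻ y₁, ∫⁻ y₂ in B, ENNReal.ofReal (min (1 - imhAccept w x y₁) (w y₂ * (1 - imhAccept w y₂ y₁) / w x)) ∂q ∂q +
        (1 - (imhAcceptMass q w x +
          ∫⁻ y₁, ∫⁻ y₂, ENNReal.ofReal (min (1 - imhAccept w x y₁) (w y₂ * (1 - imhAccept w y₂ y₁) / w x)) ∂q ∂q)) *
          B.indicator 1 x)
    [IsFiniteMeasure (q.withDensity fun y => ENNReal.ofReal (w y))]
    {f : Ω → ℝ} (hf : Measurable f) (hf0 : ∀ x, 0 ≤ f x) {c : ℝ} (hfc : ∀ x, f x ≤ c) :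
    ∫⁻ x, ∫⁻ y, ENNReal.ofReal (f x * f y) ∂(K x) ∂(q.withDensity fun y => ENNReal.ofReal (w y)) ≤
      ∫⁻ x, ∫⁻ y, ENNReal.ofReal (f x * f y) ∂(indepMH q w x) ∂(q.withDensity fun y => ENNReal.ofReal (w y)) := by
  haveI : IsMarkovKernel K := dr_isMarkovKernel hw hw0 K hK
  haveI : Fact (Measurable w) := ⟨hw⟩
  exact lagOne_cross_antitone K (indepMH q w) (fun _ _ hB hx => dr_apply_ge_indepMH hw K hK hB hx) _
    (delayedRejection_invariant hw hw0 K hK) (indepMH_invariant hw hw0) hf hf0 hfc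

end Summit.Ventures.LatticeQCDFlow.Exactness
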